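import Literature.MathematicalPhysics.QuantumFieldTheory.Balaban1983to89.B7Prop10General

/-!
# `Balaban1983to89.B7Eq178General` — T. Bałaban, *Averaging operations for lattice gauge theories*, Commun. Math. Phys.
**98** (1985) 17–51 [Balaban1985Averaging], Sect. F p. 45 [PDF 29]: **the closed form (178) of the averaged perturbation
`ũ′ʲ = \overline{R₀u′u₁}ʲ(\overline{R₀u₁}ʲ)⁻¹` AT A GENERAL BACKGROUND `U₀`**, proved equal to the tree's inductive definition (179)
(`B7Prop10General.utilG`)

statement-level skeleton of published theorems with citation tags; proofs where landed; nothing here is a claim about the Yang–Mills mass gap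

PDF held: `paper:balaban1985-cmp98-averaging` (journal page = PDF page + 16); render `…/1985-cmp98-averaging-p029-x2.png` (p. 45)
read as an image by the typing seat (unit `lit-balaban-r04`, gen 52).

CITATION HEADER / PRINT, verbatim (p. 45): "We will consider the averages `ũ′ʲ = \overline{R₀u′u₁}ʲ(\overline{R₀u₁}ʲ)⁻¹`. (178)
As in the case of averages `Ũ′ʲ`, it can be easily seen that they may be defined inductively as `ũ′¹ = ũ′ =
\overline{R₀u′u₁}(\overline{R₀u₁})⁻¹`, `ũ′^{j+1} = \overline{R̄₀ʲũ′ʲ\overline{R₀u₁}ʲ}(\overline{R̄₀ʲ\overline{R₀u₁}ʲ})⁻¹`. (179)"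
Here `\overline{R₀u}ʲ` is the `j`-th order averaging operation (79)–(80) for gauge transformations at the background `U₀`
(`B7Eq84Concrete.uavg L U₀ u j`), the one-step operation of (179) at the level background `Ū₀ʲ = B7Prop2Explicit.avgIter L U₀ j`
is `B7Prop9General.vtilG`, and `B7Prop10General.utilG` DEFINES `ũ′ʲ` by the recursion (179) (its docstring quotes (178)–(179));
at the flat background `B7Prop9Flat.util` defines `ũ′ʲ` by (178) and proves (179) (`util_succ`).

WHAT THIS FILE PROVES (kernel, 0 sorry, standard axioms; no definitions, no `def … : Prop`).
* `utilG_mul_uavg` — `ũ′ʲ · \overline{R₀u₁}ʲ = \overline{R₀(u′u₁)}ʲ` for every `j`, every `L`, every background `U₀` and all unit-valued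
  `u′`, `u₁` (no smallness): print's "it can be easily seen", the induction being `(a·b⁻¹)·b = a` at each level.
* `utilG_eq_uavg_mul_inv` — **(178) at a general background**: `ũ′ʲ(z) = \overline{R₀u′u₁}ʲ(z)·(\overline{R₀u₁}ʲ(z))⁻¹`, i.e. the
  recursion (179) of record and the closed form (178) define the same object (the general-background companion of
  `B7Prop9Flat.util_apply` ∕ `util_succ`).
Owner audit context: ROWS-B7 row `B7.Eq176` ((176)–(179)); this is the member that puts display (178) in the tree with its body at
print's generality (arbitrary `U₀`).  Unit `lit-balaban-r04` gen 52, 2026-08-23.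
-/

noncomputable section

namespace Literature.MathematicalPhysics.QuantumFieldTheory.Balaban1983to89.B7Eq178General

open B7Prop1Explicit B7Prop2Explicit B7Eq99Concrete B7Eq84Concrete B7Prop9General B7Prop10General

-- `Site` alone would resolve to the torus sites of `Setup.lean`; re-export the `ℤ^d` sites of `B7Prop1Explicit`.
export B7Prop1Explicit (Site)

variable {d : ℕ}
variable {𝔸 : Type*} [NormedRing 𝔸] [NormedAlgebra ℂ 𝔸] [CompleteSpace 𝔸]

/-- **(178) ⟸ (179), the induction** (p. 45 "it can be easily seen"): `ũ′ʲ · \overline{R₀u₁}ʲ = \overline{R₀(u′u₁)}ʲ` as functions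
on the level-`j` lattice, for the recursively defined `ũ′ʲ = B7Prop10General.utilG L U₀ u′ u₁ j` and the `j`-th order averages
(79)–(80) `B7Eq84Concrete.uavg`; every background `U₀`, no smallness. [cite: Balaban1985Averaging, (178)–(179) p.45, (79)–(80) p.30] -/
theorem utilG_mul_uavg (L : ℕ) (U₀ : Site d → Fin d → 𝔸ˣ) (u' u₁ : Site d → 𝔸ˣ) :
    ∀ j : ℕ, utilG L U₀ u' u₁ j * uavg L U₀ u₁ j = uavg L U₀ (u' * u₁) j
  | 0 => by
    funext z
    simp only [Pi.mul_apply, utilG_zero, uavg_zero]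
  | j + 1 => by
    funext z
    have ih := utilG_mul_uavg L U₀ u' u₁ j
    simp only [Pi.mul_apply, utilG_succ, uavg_succ, vtilG, inv_mul_cancel_right, ih]

/-- **(178) AT A GENERAL BACKGROUND `U₀`**, verbatim: "`ũ′ʲ = \overline{R₀u′u₁}ʲ(\overline{R₀u₁}ʲ)⁻¹`" — the inductively defined
(179) object `B7Prop10General.utilG` IS the quotient of the `j`-th order averages (79)–(80) of `u′u₁` and of `u₁`, at every
level-`j` site `z`, for every `L`, `U₀`, `u′`, `u₁`. [cite: Balaban1985Averaging, (178) p.45, (79)–(80) p.30] -/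
theorem utilG_eq_uavg_mul_inv (L : ℕ) (U₀ : Site d → Fin d → 𝔸ˣ) (u' u₁ : Site d → 𝔸ˣ) (j : ℕ) (z : Site d) :
    utilG L U₀ u' u₁ j z = uavg L U₀ (u' * u₁) j z * (uavg L U₀ u₁ j z)⁻¹ := by
  have h := congrFun (utilG_mul_uavg L U₀ u' u₁ j) z
  simp only [Pi.mul_apply] at h
  rw [← h, mul_inv_cancel_right]

/-- (178) as an identity of functions: `ũ′ʲ = \overline{R₀u′u₁}ʲ · (\overline{R₀u₁}ʲ)⁻¹`. [cite: Balaban1985Averaging, (178) p.45] -/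
theorem utilG_eq (L : ℕ) (U₀ : Site d → Fin d → 𝔸ˣ) (u' u₁ : Site d → 𝔸ˣ) (j : ℕ) :
    utilG L U₀ u' u₁ j = uavg L U₀ (u' * u₁) j * (uavg L U₀ u₁ j)⁻¹ := by
  funext z
  rw [utilG_eq_uavg_mul_inv, Pi.mul_apply, Pi.inv_apply]

end Literature.MathematicalPhysics.QuantumFieldTheory.Balaban1983to89.B7Eq178General
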